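import Literature.Geometry.Kaehler.ComplexTorusTranscendentalLatticeHomomorphisms
import Literature.Geometry.Kaehler.ComplexTorusTranscendentalLatticeGysin
import Literature.Geometry.Kaehler.ComplexTorusTranscendentalLatticeShiodaMitani
import HarnessLib

/-!
# Shioda–Mitani's `T_X` of a two-dimensional complex torus IS the degree-`2` transcendental lattice `T²_{2,1}(X)`; hence `T_X` is functorial
# under ALL homomorphisms of `2`-tori: `f^* T_{X′} ⊆ T_X`, `f_! T_X ⊆ T_{X′}`, `u^* T_X ⊆ T_X` (`u ∈ End X`), `rk T_{X′} ≤ rk T_X` for `f` onto,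
# `rk T_X = rk T_{X′}` for isogenous surfaces, `f_! f^* = det ρ_r(f)`

Layer `Literature/Geometry/Kaehler`, namespace `Literature.Geometry.Kaehler.ComplexTorus`; lane `lit-hodgefound` (Track 2
foundations library), seat p09, generation 33, row g33-#5. THEOREMS ONLY (0 definitions); no named fact, net debt 0. The BRIDGE between the
two transcendental-lattice vocabularies of the tree for a complex torus `X = E/Φ(ℤ^ι)` of dimension `2` (`e : Fin (2 + 2) ≃ ι`):

* p18 g13-#1 `transcendentalLattice Φ = T_X = {t ∈ H²(X, ℤ) | t ∧ s = 0 ∀ s ∈ S_X = Hdg¹(X, ℤ)}` (Shioda–Mitani §1 (1.5): "the orthogonal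
  complement of `S_X` in `H_X`"), the carrier of the lane's abelian-surface theory (signature `(2, 4 − ρ)`, `A_Q`, isometries, …);
* p09 g31-#11 `T²_{2,1}(X) = H²(X, ℤ) ∩ ⋂_{s ∈ Hdg^{2,1}(X, ℤ)} ker ⟨s, ·⟩_e` (written out; the every-degree annihilator under `poincarePairing`),

which COINCIDE (§1: `⟨s, t⟩_e = sign(e) ∫_X s ∧ t`, `s ∧ t = t ∧ s`, and `ζ = 0 ⟺ ∫_X ζ = 0` for top forms of a `2`-torus). Through the bridge the
functoriality of g33-#3 (`ComplexTorusTranscendentalLatticeHomomorphisms`: `f^* T(X′) ⊆ T(X)` for EVERY homomorphism, Voisin §7.3.2) and g33-#4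
(`ComplexTorusTranscendentalLatticeGysin`: the integral Gysin image, `f_! T ⊆ T′`, `f_! f^* = det`) and g31-#12 (isogenies) become statements about
Shioda–Mitani's `T_X` — so far the tree had the transport of `T_X` along ISOMORPHISMS only (p18 g13-#3 `comp_realRep_mem_transcendentalLattice`,
the invariance behind (3.19) "`X ⟶ T_X`"):

* §1 **`transcendentalLattice Φ = T²_{2,1}(X)`** (`transcendentalLattice_eq_integralHodgeAnnihilator`), `mem_transcendentalLattice_iff_forall_poincarePairing_eq_zero`.
* §2 **`f^* T_{X′} ⊆ T_X` for EVERY homomorphism `f = ρ(A) : X → X′` of two-dimensional complex tori** with `ℂ`-linear analytic representation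
  (isogenies, endomorphisms, …; no invertibility), **`u^* T_X ⊆ T_X` for `u ∈ End(X)`**, **`rk T_{X′} ≤ rk T_X` for `f` onto** (Voisin Lemma 7.28).
* §3 **the Gysin image `f_! t ∈ T_{X′}`** of `t ∈ T_X` (`⟨β, f_!t⟩_{e′} = ⟨f^*β, t⟩_e`; it exists and is integral, g33-#4), and **`f_! f^* t′ = det(A_{ee′}) · t′`**.
* §4 ISOGENOUS two-dimensional tori have transcendental lattices of the same rank: **`rk T_X = rk T_{X′}`** (g31-#12; Shioda–Mitani §3 (3.19) uses
  `T` on isomorphism classes, §4 compares `T_A` along isogenies), and `e(f)² · T_X ⊆ f^* T_{X′} ⊆ T_X` for an isogeny `f` of exponent `e(f)`.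

## FAIL-DUP disclosure

p18's `comp_realRep_mem_transcendentalLattice` (isomorphisms `BA = 1`), `IsIsomorphic.exists_transcendentalLattice_transport`,
`finrank_transcendentalLattice` (`= 6 − ρ`) are the existing special cases / neighbours; the statements here are for arbitrary homomorphisms and are
derived, not restated, from g33-#3 / g33-#4 / g31-#12 by the §1 bridge. Consumed BY NAME: `mem_transcendentalLattice_iff_torusIntegral`,
`torusIntegral_wedge_eq_orientationSign_mul_poincarePairing'`, `WedgeComm_holds`, `mem_integralHodgeAnnihilator_iff`.

## References

* [cite: ShiodaMitani1974, §1 (1.5) (definition of `T_X`), §3 (3.19)–(3.21), §4]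
* [cite: VoisinHodgeI2002, §7.3.2 (PDF pp. 150–151: `φ^*`, `φ_*` morphisms of Hodge structures, Lemma 7.28, Remark 7.29, Lemma 7.30)]
* [cite: Huybrechts2016K3, Ch. 3 §2.2 Def. 2.5 (PDF p. 58), §2.3 (PDF p. 59: abelian surfaces, `rk T = 6 − ρ`), §3.2 Cor. 3.4 (PDF p. 64)]
* [cite: Lange2023AbelianVarietiesComplex, §1.1.2 (p. 20), §6.2.4 (p. 310)]
-/

noncomputable section

open Module Function
open Literature.Analysis.Complex

namespace Literature.Geometry.Kaehler.ComplexTorus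

section SurfaceBridge

variable {ι ι' : Type*} [Fintype ι] [Fintype ι'] [DecidableEq ι] [DecidableEq ι']
  {E E' : Type*} [NormedAddCommGroup E] [NormedSpace ℂ E] [NormedAddCommGroup E'] [NormedSpace ℂ E']
  (Φ : (ι → ℝ) ≃L[ℝ] E) (Φ' : (ι' → ℝ) ≃L[ℝ] E') (e : Fin (2 + 2) ≃ ι) (e' : Fin (2 + 2) ≃ ι')

/-! ## §1 The bridge: `T_X = T²_{2,1}(X)` for a two-dimensional torus -/

omit [Fintype ι'] [DecidableEq ι'] in
/-- **`t ∈ T_X ⟺ t ∈ H²(X, ℤ) ∧ ⟨s, t⟩_e = 0 ∀ s ∈ Hdg^{2,1}(X, ℤ)`** (Shioda–Mitani's `T_X` via the tree's cup-product pairing: `t ∧ s = 0 ⟺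
∫_X t ∧ s = 0 ⟺ ⟨s, t⟩_e = 0`, as `⟨s, t⟩_e = sign(e) ∫_X s ∧ t` and `s ∧ t = t ∧ s` for `2`-forms). [cite: ShiodaMitani1974, §1 (1.5)] [cite: Lange2023AbelianVarietiesComplex, §6.2.4 (p. 310)] -/
theorem mem_transcendentalLattice_iff_forall_poincarePairing_eq_zero {t : E [⋀^Fin 2]→L[ℝ] ℂ} :
    t ∈ transcendentalLattice Φ ↔ t ∈ integralForms Φ 2 ∧
      ∀ s ∈ integralHodgeClassesIn Φ 2 1, poincarePairing Φ e rfl s t = 0 := by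
  have hcomm : ∀ s : E [⋀^Fin 2]→L[ℝ] ℂ, t.wedge s = s.wedge t := fun s ↦ by
    rw [wedge_comm_complex s t, domDomCongr_finCongr_self, show ((-1 : ℂ) ^ (2 * 2)) = 1 by norm_num, one_smul]
  have key : ∀ s : E [⋀^Fin 2]→L[ℝ] ℂ,
      torusIntegral Φ e (t.wedge s) = 0 ↔ poincarePairing Φ e rfl s t = 0 := fun s ↦ by
    rw [hcomm s, torusIntegral_wedge_eq_orientationSign_mul_poincarePairing', mul_eq_zero,
      or_iff_right (orientationSign_cast_ne_zero Φ e)]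
  rw [mem_transcendentalLattice_iff_torusIntegral Φ e]
  exact and_congr_right' (forall_congr' fun s ↦ imp_congr_right fun _ ↦ key s)

omit [Fintype ι'] [DecidableEq ι'] in
/-- **`T_X = T²_{2,1}(X)`**: Shioda–Mitani's transcendental lattice of a two-dimensional complex torus (p18's `transcendentalLattice`) is the degree-`2`
transcendental lattice of g31-#11 — the annihilator of `Hdg^{2,1}(X, ℤ) = NS(X)` in `H²(X, ℤ)` under the cup-product pairing `⟨ , ⟩_e`, for any
enumeration `e` of the lattice basis. [cite: ShiodaMitani1974, §1 (1.5)] [cite: Huybrechts2016K3, Ch. 3 §2.2 Def. 2.5 (PDF p. 58)] -/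
theorem transcendentalLattice_eq_integralHodgeAnnihilator :
    transcendentalLattice Φ = integralForms Φ 2 ⊓ ⨅ s : integralHodgeClassesIn Φ 2 1,
        (LinearMap.ker (poincarePairing Φ e rfl (s : E [⋀^Fin 2]→L[ℝ] ℂ))).toAddSubgroup := by
  ext t
  rw [mem_transcendentalLattice_iff_forall_poincarePairing_eq_zero Φ e, mem_integralHodgeAnnihilator_iff]

/-! ## §2 `T_X` is functorial under every homomorphism of two-dimensional tori -/

include e e' in
/-- **`f^* T_{X′} ⊆ T_X` for EVERY homomorphism `f = ρ(A) : X → X′` of two-dimensional complex tori** with `ℂ`-linear analytic representation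
(isogenies and endomorphisms included; no invertibility needed) — g33-#3 `comp_realRep_mem_integralHodgeAnnihilator` through the bridge. The tree's
p18 g13-#3 `comp_realRep_mem_transcendentalLattice` is the case of an isomorphism.
[cite: VoisinHodgeI2002, §7.3.2 (PDF pp. 150–151)] [cite: ShiodaMitani1974, §1 (1.5) and §3 (3.19)] -/
theorem comp_realRep_mem_transcendentalLattice_of_hom (A : Matrix ι' ι ℤ)
    (hA : ∀ (c : ℂ) (u : E), realRep Φ Φ' A (c • u) = c • realRep Φ Φ' A u) {t' : E' [⋀^Fin 2]→L[ℝ] ℂ}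
    (ht' : t' ∈ transcendentalLattice Φ') : t'.compContinuousLinearMap (realRep Φ Φ' A) ∈ transcendentalLattice Φ := by
  rw [transcendentalLattice_eq_integralHodgeAnnihilator Φ' e'] at ht'
  rw [transcendentalLattice_eq_integralHodgeAnnihilator Φ e]
  exact comp_realRep_mem_integralHodgeAnnihilator Φ Φ' e e' rfl rfl A hA (p := 1) (p' := 1) rfl rfl ht'

include e in
omit [Fintype ι'] [DecidableEq ι'] in
/-- **`u^* T_X ⊆ T_X` for every endomorphism `u = ρ(A) ∈ End(X)`** of a two-dimensional complex torus (`ℂ`-linear analytic representation): `T_X` is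
stable under the contravariant action of `End(X)`. [cite: VoisinHodgeI2002, §7.3.2 (PDF pp. 150–151)] [cite: Huybrechts2016K3, Ch. 3 §3.2 Cor. 3.4 (PDF p. 64)] -/
theorem comp_realRep_mem_transcendentalLattice_of_end (A : Matrix ι ι ℤ)
    (hA : ∀ (c : ℂ) (u : E), realRep Φ Φ A (c • u) = c • realRep Φ Φ A u) {t : E [⋀^Fin 2]→L[ℝ] ℂ}
    (ht : t ∈ transcendentalLattice Φ) : t.compContinuousLinearMap (realRep Φ Φ A) ∈ transcendentalLattice Φ :=
  comp_realRep_mem_transcendentalLattice_of_hom Φ Φ e e A hA ht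

include e e' in
/-- **`f^*|_{T} : T_{X′} → T_X` as a `ℤ`-linear map**, for every homomorphism `f` of two-dimensional tori.
[cite: VoisinHodgeI2002, §7.3.2 (PDF pp. 150–151)] -/
theorem exists_intLinearMap_transcendentalLattice_comp_realRep (A : Matrix ι' ι ℤ)
    (hA : ∀ (c : ℂ) (u : E), realRep Φ Φ' A (c • u) = c • realRep Φ Φ' A u) :
    ∃ R : transcendentalLattice Φ' →ₗ[ℤ] transcendentalLattice Φ,
      ∀ t', (R t' : E [⋀^Fin 2]→L[ℝ] ℂ) = (t' : E' [⋀^Fin 2]→L[ℝ] ℂ).compContinuousLinearMap (realRep Φ Φ' A) :=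
  ⟨(AddMonoidHom.mk' (fun t' ↦ ⟨(t' : E' [⋀^Fin 2]→L[ℝ] ℂ).compContinuousLinearMap (realRep Φ Φ' A),
      comp_realRep_mem_transcendentalLattice_of_hom Φ Φ' e e' A hA t'.2⟩) fun _ _ ↦ Subtype.ext (by ext v; rfl)).toIntLinearMap,
    fun _ ↦ rfl⟩

include e e' in
/-- **`rk T_{X′} ≤ rk T_X` for a SURJECTIVE homomorphism `f : X → X′` of two-dimensional complex tori** (Voisin Lemma 7.28: `f^*` is injective; e.g.
every isogeny). [cite: VoisinHodgeI2002, §7.3.2 Lemma 7.28 (PDF p. 150)] [cite: Huybrechts2016K3, Ch. 3 §2.3 (PDF p. 59)] -/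
theorem finrank_transcendentalLattice_le_of_surjective (A : Matrix ι' ι ℤ)
    (hA : ∀ (c : ℂ) (u : E), realRep Φ Φ' A (c • u) = c • realRep Φ Φ' A u) (hsurj : Surjective (realRep Φ Φ' A)) :
    finrank ℤ (transcendentalLattice Φ') ≤ finrank ℤ (transcendentalLattice Φ) := by
  rw [transcendentalLattice_eq_integralHodgeAnnihilator Φ' e', transcendentalLattice_eq_integralHodgeAnnihilator Φ e]
  exact finrank_integralHodgeAnnihilator_le_of_surjective Φ Φ' e e' rfl rfl A hA hsurj (p := 1) (p' := 1) rfl rfl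

/-! ## §3 The Gysin image: `f_! T_X ⊆ T_{X′}`, `f_! f^* = det ρ_r(f)` -/

/-- **The Gysin image `f_! t` of a transcendental cocycle is transcendental: `f_! T_X ⊆ T_{X′}`** for every homomorphism `f = ρ(A) : X → X′` of
two-dimensional tori — if `t ∈ T_X` and `t′ ∈ H²(X′, ℂ)` satisfies the adjunction identity `⟨β, t′⟩_{e′} = ⟨f^*β, t⟩_e` for all `β` (such a `t′`
exists uniquely and is integral, g33-#4), then `t′ ∈ T_{X′}`. [cite: VoisinHodgeI2002, §7.3.2 (PDF p. 151: "`(φ_*α, β)_Y = (α, φ^*β)_X`")] [cite: ShiodaMitani1974, §1 (1.5)] -/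
theorem mem_transcendentalLattice_of_forall_poincarePairing_eq_comp_realRep (A : Matrix ι' ι ℤ)
    (hA : ∀ (c : ℂ) (u : E), realRep Φ Φ' A (c • u) = c • realRep Φ Φ' A u) {t : E [⋀^Fin 2]→L[ℝ] ℂ}
    (ht : t ∈ transcendentalLattice Φ) {t' : E' [⋀^Fin 2]→L[ℝ] ℂ}
    (ht' : ∀ β : E' [⋀^Fin 2]→L[ℝ] ℂ,
      poincarePairing Φ' e' rfl β t' = poincarePairing Φ e rfl (β.compContinuousLinearMap (realRep Φ Φ' A)) t) :
    t' ∈ transcendentalLattice Φ' := by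
  rw [transcendentalLattice_eq_integralHodgeAnnihilator Φ e] at ht
  rw [transcendentalLattice_eq_integralHodgeAnnihilator Φ' e']
  exact mem_integralHodgeAnnihilator_of_forall_poincarePairing_eq_comp_realRep Φ Φ' e e' rfl rfl A hA 1 ht ht'

/-- **Existence of the (integral) Gysin image in `T_{X′}`**: every `t ∈ T_X` has a `t′ ∈ T_{X′}` with `⟨β, t′⟩_{e′} = ⟨f^*β, t⟩_e` for all `β`.
[cite: VoisinHodgeI2002, §7.3.2 (PDF p. 151: `φ_* = PD⁻¹ ∘ ᵗ(φ^*) ∘ PD`)] [cite: Lange2023AbelianVarietiesComplex, §6.2.4 (p. 310)] -/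
theorem exists_mem_transcendentalLattice_forall_poincarePairing_eq_comp_realRep (A : Matrix ι' ι ℤ)
    (hA : ∀ (c : ℂ) (u : E), realRep Φ Φ' A (c • u) = c • realRep Φ Φ' A u) {t : E [⋀^Fin 2]→L[ℝ] ℂ}
    (ht : t ∈ transcendentalLattice Φ) :
    ∃ t' ∈ transcendentalLattice Φ', ∀ β : E' [⋀^Fin 2]→L[ℝ] ℂ,
      poincarePairing Φ' e' rfl β t' = poincarePairing Φ e rfl (β.compContinuousLinearMap (realRep Φ Φ' A)) t := by
  obtain ⟨t', ht'⟩ := exists_forall_poincarePairing_eq_comp_realRep Φ Φ' e e' (rfl : 2 + 2 = 2 + 2) (rfl : 2 + 2 = 2 + 2) A t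
  exact ⟨t', mem_transcendentalLattice_of_forall_poincarePairing_eq_comp_realRep Φ Φ' e e' A hA ht ht', ht'⟩

/-- **`f_! f^* t′ = det(A_{ẽ′ẽ}) · t′`** on `H²` of two-dimensional tori (Voisin Remark 7.29 "`φ_* ∘ φ^* = d Id`"): if `x′` satisfies the adjunction
identity for `x = f^*t′` then `x′ = det(A_{ẽ′ẽ}) t′`. [cite: VoisinHodgeI2002, §7.3.2 Remark 7.29 (PDF p. 150)] [cite: Lange2023AbelianVarietiesComplex, §1.7.2 Cor. 1.7.6 (proof)] -/
theorem eq_det_smul_of_forall_poincarePairing_eq_comp_realRep_two (A : Matrix ι' ι ℤ) (t' : E' [⋀^Fin 2]→L[ℝ] ℂ)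
    {x' : E' [⋀^Fin 2]→L[ℝ] ℂ}
    (hx' : ∀ β : E' [⋀^Fin 2]→L[ℝ] ℂ, poincarePairing Φ' e' rfl β x' =
      poincarePairing Φ e rfl (β.compContinuousLinearMap (realRep Φ Φ' A)) (t'.compContinuousLinearMap (realRep Φ Φ' A))) :
    x' = ((A.submatrix ((finCongr (rfl : 2 + 2 = 2 + 2)).trans e') ((finCongr (rfl : 2 + 2 = 2 + 2)).trans e)).det : ℂ) • t' :=
  eq_det_smul_of_forall_poincarePairing_eq_comp_realRep Φ Φ' A e e' rfl t' hx'

/-! ## §4 Isogenous two-dimensional tori: `rk T_X = rk T_{X′}`, `e(f)² · T_X ⊆ f^* T_{X′}` -/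

include e e' in
/-- **`rk T_X = rk T_{X′}` along an isogeny `f = ρ(A) : X → X′` of two-dimensional complex tori** (g31-#12 through the bridge).
[cite: ShiodaMitani1974, §3 (3.19)] [cite: Lange2023AbelianVarietiesComplex, §1.1.2 Prop. 1.1.15 (PDF p. 22)] -/
theorem IsIsogeny.finrank_transcendentalLattice_eq {A : Matrix ι' ι ℤ} (hf : IsIsogeny Φ Φ' A) :
    finrank ℤ (transcendentalLattice Φ) = finrank ℤ (transcendentalLattice Φ') := by
  rw [transcendentalLattice_eq_integralHodgeAnnihilator Φ e, transcendentalLattice_eq_integralHodgeAnnihilator Φ' e']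
  exact hf.finrank_integralHodgeAnnihilator_eq Φ Φ' e e' rfl 1

include e e' in
/-- **Isogenous two-dimensional complex tori have transcendental lattices of the same rank.**
[cite: ShiodaMitani1974, §3 (3.19)] [cite: Huybrechts2016K3, Ch. 3 §2.3 (PDF p. 59)] -/
theorem IsIsogenous.finrank_transcendentalLattice_eq (hiso : IsIsogenous Φ Φ') :
    finrank ℤ (transcendentalLattice Φ) = finrank ℤ (transcendentalLattice Φ') := by
  obtain ⟨A, hA⟩ := hiso
  exact hA.finrank_transcendentalLattice_eq Φ Φ' e e'

include e e' in
/-- **`f^* T_{X′} ⊆ T_X` along an isogeny** (no extra hypothesis: an isogeny has `ℂ`-linear analytic representation).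
[cite: ShiodaMitani1974, §3 (3.19)] [cite: Lange2023AbelianVarietiesComplex, §1.1.2 Prop. 1.1.15 (PDF p. 22)] -/
theorem IsIsogeny.comp_realRep_mem_transcendentalLattice {A : Matrix ι' ι ℤ} (hf : IsIsogeny Φ Φ' A) {t' : E' [⋀^Fin 2]→L[ℝ] ℂ}
    (ht' : t' ∈ transcendentalLattice Φ') : t'.compContinuousLinearMap (realRep Φ Φ' A) ∈ transcendentalLattice Φ :=
  comp_realRep_mem_transcendentalLattice_of_hom Φ Φ' e e' A hf.realRep_smul ht'

include e e' in
/-- **`e(f)² · T_X ⊆ f^* T_{X′}`** for an isogeny `f` of exponent `e(f)` between two-dimensional tori: every `t ∈ T_X` has `e(f)² t = f^*t′` with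
`t′ ∈ T_{X′}` (`t′ = g^*t` for the quasi-inverse `g`, `gf = e(f)_X`; g31-#12). [cite: Lange2023AbelianVarietiesComplex, §1.1.2 Prop. 1.1.15 (PDF p. 22)] [cite: ShiodaMitani1974, §3 (3.19)] -/
theorem IsIsogeny.exists_comp_realRep_eq_sq_smul_of_mem_transcendentalLattice {A : Matrix ι' ι ℤ} (hf : IsIsogeny Φ Φ' A)
    {t : E [⋀^Fin 2]→L[ℝ] ℂ} (ht : t ∈ transcendentalLattice Φ) :
    ∃ t' ∈ transcendentalLattice Φ',
      t'.compContinuousLinearMap (realRep Φ Φ' A) = ((AddMonoid.exponent (mapMatrixHom Φ Φ' A).ker : ℂ) ^ 2) • t := by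
  rw [transcendentalLattice_eq_integralHodgeAnnihilator Φ e] at ht
  obtain ⟨t', ht', heq⟩ := hf.exists_comp_realRep_eq_pow_smul_of_mem_integralHodgeAnnihilator Φ Φ' e e' rfl 1 ht
  rw [← transcendentalLattice_eq_integralHodgeAnnihilator Φ' e'] at ht'
  exact ⟨t', ht', heq⟩

end SurfaceBridge

end Literature.Geometry.Kaehler.ComplexTorus
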